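import Mathlib
import Summits.MatrixMultiplication.MatrixMultiplication.Theorems.ThinPackings.Negative.TriageRuledGraphPatternedArc

set_option linter.dupNamespace false

/-!
# Stub `stub_boxFreiman` — Freiman box transfer of label-weighted STPP families

Crux `stmt-MatrixMultiplication-10595` (`Theses.ThinBlockAlpha.ThinPackings`), line
`label-weighted-stpp-debordering`.

A label-weighted STPP family (`IsLabelWeightedSTPP A B C κ μ`, the landed predicate of
`Theorems/ThinPackings/Negative/TriageRuledGraphPatternedArc.lean`) of integer vectors supported in the
box `[-b, b]^D` stays label-weighted, with the same potentials `κ, μ` and the same cardinalities, after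
coordinatewise reduction modulo any `m > 6b`, i.e. under the map
`φ v := fun t => (v t : ZMod m) : (Fin D → ℤ) → (Fin D → ZMod m)`.

Proof: every clause of `IsLabelWeightedSTPP` is a signed relation among at most six vectors of the box
(`(s' - s) + (t' - t) + (u' - u) = 0`, or the four-term packing relations `s - t = s' - t'`).  Elements
of the image sets pull back to box vectors; a reduced relation holds coordinatewise, and at each
coordinate the integer combination `z` has `|z| ≤ 6b < m` and reduces to `0` modulo `m`, hence `z = 0`
(`reflect6`, `reflect4`).  So the integer clause fires and its conclusions push forward to the images.
The map `φ` is injective on every box set (`injOn_box`), which gives the cardinalities.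
-/

namespace Summit.MatrixMultiplication.MatrixMultiplication.Theorems.ThinPackings

open Finset
open Literature.Computability.AlgebraicComplexity (IsSTPP)
open Summit.MatrixMultiplication.MatrixMultiplication.Theorems.ThinPackings.Negative.Triage2 (IsLabelWeightedSTPP)

section Helpers

variable {D b m : ℕ}

/-- An integer of absolute value `< m` whose reduction modulo `m` vanishes is zero. -/
private theorem int_eq_zero_of_cast_eq_zero {z : ℤ} (hz : (z : ZMod m) = 0) (hlt : |z| < (m : ℤ)) :
    z = 0 :=
  Int.eq_zero_of_abs_lt_dvd ((ZMod.intCast_zmod_eq_zero_iff_dvd z m).1 hz) hlt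

/-- **Six-term reflection.** If six vectors of the box `[-b, b]^D` satisfy the relation
`(s' - s) + (t' - t) + (u' - u) = 0` after coordinatewise reduction modulo `m > 6b`, then they
satisfy it in `ℤ^D`. -/
private theorem reflect6 {φ : (Fin D → ℤ) → (Fin D → ZMod m)} (hφ : ∀ v c, φ v c = (v c : ZMod m))
    (hbm : 6 * b < m) {s s' t t' u u' : Fin D → ℤ}
    (h : φ s' - φ s + (φ t' - φ t) + (φ u' - φ u) = 0)
    (hs : ∀ c, |s c| ≤ (b : ℤ)) (hs' : ∀ c, |s' c| ≤ (b : ℤ)) (ht : ∀ c, |t c| ≤ (b : ℤ))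
    (ht' : ∀ c, |t' c| ≤ (b : ℤ)) (hu : ∀ c, |u c| ≤ (b : ℤ)) (hu' : ∀ c, |u' c| ≤ (b : ℤ)) :
    s' - s + (t' - t) + (u' - u) = 0 := by
  funext c
  simp only [Pi.add_apply, Pi.sub_apply, Pi.zero_apply]
  refine int_eq_zero_of_cast_eq_zero (m := m) ?_ ?_
  · have hc := congr_fun h c
    simp only [Pi.add_apply, Pi.sub_apply, Pi.zero_apply, hφ] at hc
    exact_mod_cast hc
  · have h1 := abs_le.1 (hs c)
    have h2 := abs_le.1 (hs' c)
    have h3 := abs_le.1 (ht c)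
    have h4 := abs_le.1 (ht' c)
    have h5 := abs_le.1 (hu c)
    have h6 := abs_le.1 (hu' c)
    rw [abs_lt]
    constructor <;> omega

/-- **Four-term reflection** (the packing shape): if four vectors of the box `[-b, b]^D` satisfy
`s - t = s' - t'` after coordinatewise reduction modulo `m > 6b`, then they satisfy it in `ℤ^D`. -/
private theorem reflect4 {φ : (Fin D → ℤ) → (Fin D → ZMod m)} (hφ : ∀ v c, φ v c = (v c : ZMod m))
    (hbm : 6 * b < m) {s t s' t' : Fin D → ℤ} (h : φ s - φ t = φ s' - φ t')
    (hs : ∀ c, |s c| ≤ (b : ℤ)) (ht : ∀ c, |t c| ≤ (b : ℤ)) (hs' : ∀ c, |s' c| ≤ (b : ℤ))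
    (ht' : ∀ c, |t' c| ≤ (b : ℤ)) : s - t = s' - t' := by
  have h0 : φ s - φ s' + (φ t' - φ t) + (φ s - φ s) = 0 := by linear_combination h
  have h1 := reflect6 hφ hbm h0 hs' hs ht ht' hs hs
  linear_combination h1

/-- The coordinatewise reduction modulo `m > 6b` is injective on every subset of the box
`[-b, b]^D`. -/
private theorem injOn_box {φ : (Fin D → ℤ) → (Fin D → ZMod m)} (hφ : ∀ v c, φ v c = (v c : ZMod m))
    (hbm : 6 * b < m) {S : Finset (Fin D → ℤ)} (hS : ∀ v ∈ S, ∀ c, |v c| ≤ (b : ℤ)) :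
    Set.InjOn φ S := by
  intro v hv w hw hvw
  have h0 : φ v - φ w + (φ v - φ v) + (φ v - φ v) = 0 := by linear_combination hvw
  have h1 := reflect6 hφ hbm h0 (hS w hw) (hS v hv) (hS v hv) (hS v hv) (hS v hv) (hS v hv)
  linear_combination h1

/-- **Transport of a label-weighted STPP family** along any map `φ` which is the coordinatewise
reduction modulo `m > 6b`, for families supported in the box `[-b, b]^D`: the image family is
label-weighted with the same potentials, and the cardinalities are preserved. -/
private theorem transport (φ : (Fin D → ℤ) → (Fin D → ZMod m))
    (hφ : ∀ v c, φ v c = (v c : ZMod m)) (hbm : 6 * b < m) {L : ℕ}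
    {A B C : Fin L → Finset (Fin D → ℤ)} {κ μ : Fin L → ℤ}
    (hbox : ∀ i, (∀ v ∈ A i, ∀ t, |v t| ≤ (b : ℤ)) ∧ (∀ v ∈ B i, ∀ t, |v t| ≤ (b : ℤ)) ∧
      (∀ v ∈ C i, ∀ t, |v t| ≤ (b : ℤ)))
    (hW : IsLabelWeightedSTPP A B C κ μ) :
    IsLabelWeightedSTPP (fun i => (A i).image φ) (fun i => (B i).image φ)
        (fun i => (C i).image φ) κ μ ∧
      (∀ i, ((A i).image φ).card = (A i).card ∧ ((B i).image φ).card = (B i).card ∧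
        ((C i).image φ).card = (C i).card) := by
  have hA : ∀ i, ∀ v ∈ A i, ∀ c, |v c| ≤ (b : ℤ) := fun i => (hbox i).1
  have hB : ∀ i, ∀ v ∈ B i, ∀ c, |v c| ≤ (b : ℤ) := fun i => (hbox i).2.1
  have hC : ∀ i, ∀ v ∈ C i, ∀ c, |v c| ≤ (b : ℤ) := fun i => (hbox i).2.2
  obtain ⟨h1, h2, h3, h4, h5⟩ := hW
  refine ⟨⟨?_, ?_, ?_, ?_, ?_⟩, fun i => ⟨card_image_of_injOn (injOn_box hφ hbm (hA i)),
    card_image_of_injOn (injOn_box hφ hbm (hB i)),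
    card_image_of_injOn (injOn_box hφ hbm (hC i))⟩⟩
  · -- clause (1): the `A/B` packing
    intro i k s hs t ht s' hs' t' ht' he
    obtain ⟨s₀, hs₀, rfl⟩ := mem_image.1 hs
    obtain ⟨t₀, ht₀, rfl⟩ := mem_image.1 ht
    obtain ⟨s₁, hs₁, rfl⟩ := mem_image.1 hs'
    obtain ⟨t₁, ht₁, rfl⟩ := mem_image.1 ht'
    have he' := reflect4 hφ hbm he (hA i s₀ hs₀) (hB i t₀ ht₀) (hA k s₁ hs₁) (hB k t₁ ht₁)
    obtain ⟨hik, hss, htt⟩ := h1 i k s₀ hs₀ t₀ ht₀ s₁ hs₁ t₁ ht₁ he'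
    exact ⟨hik, by rw [hss], by rw [htt]⟩
  · -- clause (2): the `B/C` packing
    intro j k t ht u hu t' ht' u' hu' he
    obtain ⟨t₀, ht₀, rfl⟩ := mem_image.1 ht
    obtain ⟨u₀, hu₀, rfl⟩ := mem_image.1 hu
    obtain ⟨t₁, ht₁, rfl⟩ := mem_image.1 ht'
    obtain ⟨u₁, hu₁, rfl⟩ := mem_image.1 hu'
    have he' := reflect4 hφ hbm he (hB j t₀ ht₀) (hC j u₀ hu₀) (hB k t₁ ht₁) (hC k u₁ hu₁)
    obtain ⟨hjk, htt, huu⟩ := h2 j k t₀ ht₀ u₀ hu₀ t₁ ht₁ u₁ hu₁ he'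
    exact ⟨hjk, by rw [htt], by rw [huu]⟩
  · -- clause (3): the `C/A` packing
    intro i k u hu s hs u' hu' s' hs' he
    obtain ⟨u₀, hu₀, rfl⟩ := mem_image.1 hu
    obtain ⟨s₀, hs₀, rfl⟩ := mem_image.1 hs
    obtain ⟨u₁, hu₁, rfl⟩ := mem_image.1 hu'
    obtain ⟨s₁, hs₁, rfl⟩ := mem_image.1 hs'
    have he' := reflect4 hφ hbm he (hC i u₀ hu₀) (hA i s₀ hs₀) (hC k u₁ hu₁) (hA k s₁ hs₁)
    obtain ⟨hik, huu, hss⟩ := h3 i k u₀ hu₀ s₀ hs₀ u₁ hu₁ s₁ hs₁ he'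
    exact ⟨hik, by rw [huu], by rw [hss]⟩
  · -- clause (4): the TPP inside a block
    intro i s hs s' hs' t ht t' ht' u hu u' hu' he
    obtain ⟨s₀, hs₀, rfl⟩ := mem_image.1 hs
    obtain ⟨s₁, hs₁, rfl⟩ := mem_image.1 hs'
    obtain ⟨t₀, ht₀, rfl⟩ := mem_image.1 ht
    obtain ⟨t₁, ht₁, rfl⟩ := mem_image.1 ht'
    obtain ⟨u₀, hu₀, rfl⟩ := mem_image.1 hu
    obtain ⟨u₁, hu₁, rfl⟩ := mem_image.1 hu'
    have he' := reflect6 hφ hbm he (hA i s₀ hs₀) (hA i s₁ hs₁) (hB i t₀ ht₀) (hB i t₁ ht₁)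
      (hC i u₀ hu₀) (hC i u₁ hu₁)
    obtain ⟨hss, htt, huu⟩ := h4 i s₀ hs₀ s₁ hs₁ t₀ ht₀ t₁ ht₁ u₀ hu₀ u₁ hu₁ he'
    exact ⟨by rw [hss], by rw [htt], by rw [huu]⟩
  · -- clause (5): admissible cross relations have weight `≥ 1`
    intro i j k hijk s hs s' hs' t ht t' ht' u hu u' hu' he
    obtain ⟨s₀, hs₀, rfl⟩ := mem_image.1 hs
    obtain ⟨s₁, hs₁, rfl⟩ := mem_image.1 hs'
    obtain ⟨t₀, ht₀, rfl⟩ := mem_image.1 ht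
    obtain ⟨t₁, ht₁, rfl⟩ := mem_image.1 ht'
    obtain ⟨u₀, hu₀, rfl⟩ := mem_image.1 hu
    obtain ⟨u₁, hu₁, rfl⟩ := mem_image.1 hu'
    have he' := reflect6 hφ hbm he (hA k s₀ hs₀) (hA i s₁ hs₁) (hB i t₀ ht₀) (hB j t₁ ht₁)
      (hC j u₀ hu₀) (hC k u₁ hu₁)
    exact h5 i j k hijk s₀ hs₀ s₁ hs₁ t₀ ht₀ t₁ ht₁ u₀ hu₀ u₁ hu₁ he'

end Helpers

/-- **Freiman box transfer** (stub `stub_boxFreiman` of line `label-weighted-stpp-debordering`):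
a label-weighted STPP family of integer vectors supported in the box `[-b, b]^D` stays label-weighted,
with the same potentials `κ, μ` and the same cardinalities, after coordinatewise reduction modulo any
`m > 6b`. [new, elementary] -/
theorem stub_boxFreiman :
    ∀ (D L b m : ℕ) (A B C : Fin L → Finset (Fin D → ℤ)) (κ μ : Fin L → ℤ),
      6 * b < m →
      (∀ i, (∀ v ∈ A i, ∀ t, |v t| ≤ (b : ℤ)) ∧ (∀ v ∈ B i, ∀ t, |v t| ≤ (b : ℤ)) ∧
        (∀ v ∈ C i, ∀ t, |v t| ≤ (b : ℤ))) →
      IsLabelWeightedSTPP A B C κ μ →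
      IsLabelWeightedSTPP (fun i => (A i).image (fun (v : Fin D → ℤ) (t : Fin D) => (v t : ZMod m)))
          (fun i => (B i).image (fun (v : Fin D → ℤ) (t : Fin D) => (v t : ZMod m)))
          (fun i => (C i).image (fun (v : Fin D → ℤ) (t : Fin D) => (v t : ZMod m))) κ μ ∧
      (∀ i, ((A i).image (fun (v : Fin D → ℤ) (t : Fin D) => (v t : ZMod m))).card = (A i).card ∧
        ((B i).image (fun (v : Fin D → ℤ) (t : Fin D) => (v t : ZMod m))).card = (B i).card ∧
        ((C i).image (fun (v : Fin D → ℤ) (t : Fin D) => (v t : ZMod m))).card = (C i).card) :=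
  fun D _L _b m _A _B _C _κ _μ hbm hbox hW =>
    transport (fun (v : Fin D → ℤ) (t : Fin D) => (v t : ZMod m)) (fun _ _ => rfl) hbm hbox hW

end Summit.MatrixMultiplication.MatrixMultiplication.Theorems.ThinPackings
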